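import Literature.NumberTheory.LFunctions.Zhang2022.NumericsSection12Windows
import Literature.NumberTheory.LFunctions.Zhang2022.Section10Certificate
import Literature.NumberTheory.LFunctions.Zhang2022.Section2AllIota

/-!
# Zhang (2022) §12: the EXACT main-value reading of the window integrals in closed form (num lane N-07/N-08, part A)

Trunk T-ANT (NumberTheory/LFunctions). Companion of `NumericsSection12.lean` / `NumericsSection12Windows.lean`
(certified-numerics lane of the siegel-zhang campaign, rows N-07/N-08, writer sz-num-5; Y. Zhang, arXiv:2211.02515v1
[Zhang2022LandauSiegel], §12 pp.68–74 — **an unrefereed manuscript under adjudication; nothing here is a statement about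
its theorems or about Landau–Siegel zeros**).

`NumericsSection12` types the p.72 window displays and (12.14)–(12.17) as `Prop`s parametrised by a reading `w` of the
weight `𝔴_j(P^z)`; `NumericsSection12Windows` proves them in the kernel for the author's LINEARISED reading. This file and
`NumericsSection12ExactB` do the same for the EXACT main-value reading `w = wExact` (`𝔴_j = −D_j(z − 0.496)`, `D_j` the
derivative expression displayed in the proof of Lemma 12.3) and for the conjugate weight `w = wStarExact` of (12.16)
(`𝔴*_j` from the proof of Lemma 12.1), using the `CubE` (cubic × exponential) closed-form engine of `Section10ClosedForm`
and its box mirror in `Section10Certificate`: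

* `K0_closed`, `K1_closed`, `Dmain_closed` — `K₀, K₁` and `D_j(u) = C_j + e^{3πiu/2}(A_j + B_j u)` in closed form
  (`β₄ := β₁, β₅ := β₂`, `n_j = 11 − 6j + j²`, `w = 2/(3π)`);
* `wExact_eq`, `wStarExact_eq`, `wLin_eq` — the three weights as linear-exponentials (`DLin`, `WsLin`, `WlLin`);
* `integral_X/Y/J`, `windows_exact_eq`, `windows_gh_eq` — the window integrals `I6, I7` (𝔣𝔣-profiles, exact `w`) and
  `J6, J7` (𝔤𝔥-profiles, both readings) as `CubE.integ` sums over the rational windows `[62/125, 249/500]`, `[62/125, 1/2]`;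
* the box mirrors `XValB`, `YValB`, `JValB` with their `mem` lemmas (fixed-point interval engine, scale `2⁴⁸`;
  `dR0496` is `Section10ClosedForm`'s, `mem_natCB` is `Section2AllIota`'s).

Part B (`NumericsSection12ExactB.lean`) assembles (12.14)–(12.17) and runs the kernel certificate. Lineage 2 (kit job
j247240, mpmath.iv / Arb) agrees with every bracket.
-/

noncomputable section

open Complex Real ComplexConjugate
open Literature.Analysis.ValidatedNumerics.Numerics

namespace Literature.NumberTheory.LFunctions.Zhang2022.Numerics

open Literature.NumberTheory.LFunctions.Zhang2022

/-! ### Closed form of the main-value derivative expression `D_j` (exact reading) -/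

/-- `1/ω` for `ω = 3π/2`: `w = (2/3)/π`. [cite: Zhang2022LandauSiegel, proof of Lemma 12.3 (p.70)] -/
def wK : ℝ := overPi (2/3)

/-- `K₀(v) = w·i·(1 − e^{(3/2)πiv})` (`w = 2/(3π)`). [cite: Zhang2022LandauSiegel, proof of Lemma 12.3 (p.70)] -/
theorem K0_closed (v : ℝ) : K0 v = (wK : ℂ) * I * (1 - cexp ((((3/2 : ℝ) * v * π : ℝ) : ℂ) * I)) := by
  have e1 := integral_quad_mul_cexp 1 0 0 (m := 3/2) (by norm_num) v
  have hint : (∫ z in (0:ℝ)..v, cexp (3 * π * I * z / 2))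
      = ∫ z in (0:ℝ)..v, (1 + 0 * (z : ℂ) + 0 * ((z : ℂ) * z)) * cexp (((3/2 : ℚ) : ℂ) * π * I * z) := by
    refine intervalIntegral.integral_congr (fun z _ => ?_)
    have h : cexp (3 * π * I * z / 2) = cexp (((3/2 : ℚ) : ℂ) * π * I * z) := by
      congr 1; push_cast; ring
    rw [h]; ring
  unfold K0; rw [hint, e1]; unfold expQuadInt Pz P0 P1 P2 wK
  have hw : overPi (3/2 : ℚ)⁻¹ = overPi (2/3) := by norm_num
  rw [hw]; push_cast; ring

/-- `K₁(v) = (w² − w·i·v)e^{(3/2)πiv} − w²`. [cite: Zhang2022LandauSiegel, proof of Lemma 12.3 (p.70)] -/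
theorem K1_closed (v : ℝ) :
    K1 v = (((wK : ℂ)) ^ 2 - (wK : ℂ) * I * v) * cexp ((((3/2 : ℝ) * v * π : ℝ) : ℂ) * I) - (wK : ℂ) ^ 2 := by
  have e1 := integral_quad_mul_cexp 0 1 0 (m := 3/2) (by norm_num) v
  have hint : (∫ z in (0:ℝ)..v, (z : ℂ) * cexp (3 * π * I * z / 2))
      = ∫ z in (0:ℝ)..v, (0 + 1 * (z : ℂ) + 0 * ((z : ℂ) * z)) * cexp (((3/2 : ℚ) : ℂ) * π * I * z) := by
    refine intervalIntegral.integral_congr (fun z _ => ?_)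
    have h : cexp (3 * π * I * z / 2) = cexp (((3/2 : ℚ) : ℂ) * π * I * z) := by
      congr 1; push_cast; ring
    rw [h]; ring
  unfold K1; rw [hint, e1]; unfold expQuadInt Pz P0 P1 P2 wK
  have hw : overPi (3/2 : ℚ)⁻¹ = overPi (2/3) := by norm_num
  rw [hw]; push_cast; ring

/-- constant part of `D_j`: `C_j = e^{(3/500)πi}·n_jπ²(w² − w·i/250)`. [cite: Zhang2022LandauSiegel, proof of Lemma 12.3 (p.70)] -/
def DC (j : ℕ) : ℂ := eIpi (3/500) * ((nj j : ℂ) * π ^ 2 * ((wK : ℂ) ^ 2 - (wK : ℂ) * I * (((1/250 : ℚ) : ℝ) : ℂ)))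
/-- `A_j = 1 − n_jπ²w²` (coefficient of `e^{3πiu/2}`). [cite: Zhang2022LandauSiegel, proof of Lemma 12.3 (p.70)] -/
def DA (j : ℕ) : ℂ := 1 - (nj j : ℂ) * π ^ 2 * (wK : ℂ) ^ 2
/-- `B_j = n_jπ²w·i − (9/2 − j)πi` (coefficient of `u·e^{3πiu/2}`). [cite: Zhang2022LandauSiegel, proof of Lemma 12.3 (p.70)] -/
def DB (j : ℕ) : ℂ := (nj j : ℂ) * π ^ 2 * (wK : ℂ) * I - (9 / 2 - (j : ℂ)) * π * I

/-- **Closed form of `D_j`:** `D_j(u) = C_j + e^{3πiu/2}(A_j + B_j u)`. [cite: Zhang2022LandauSiegel, proof of Lemma 12.3 (p.70)] -/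
theorem Dmain_closed (j : ℕ) (u : ℝ) : Dmain j u = DC j + cexp (3 * π * I * u / 2) * (DA j + DB j * u) := by
  unfold Dmain DC DA DB eIpi
  rw [K0_closed, K1_closed]
  have hEF : cexp (3 * π * I * u / 2) * cexp ((((3/2 : ℝ) * (0.004 - u) * π : ℝ) : ℂ) * I)
      = cexp ((((3/500 : ℚ) : ℝ) * π : ℝ) * I) := by
    rw [← Complex.exp_add]; congr 1; push_cast; ring
  have e4 : ((((1/250 : ℚ) : ℝ) : ℂ)) = (0.004 : ℂ) := by norm_num
  rw [e4]
  push_cast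
  push_cast at hEF
  linear_combination ((nj j : ℂ) * (π : ℂ) ^ 2 * ((wK : ℂ) ^ 2 - (wK : ℂ) * I * ((0.004 : ℂ) - (u : ℂ)) - (wK : ℂ) * I * (u : ℂ))) * hEF

/-! ### The exact-reading weights and the window integrands as `CubE` sums -/

/-- `0.498 = 249/500`. [cite: Zhang2022LandauSiegel, §12 p.72] -/
theorem dR0498 : (0.498 : ℝ) = ((249/500 : ℚ) : ℝ) := by norm_num

/-- product of two linear-exponentials `(u₀+u₁z)e^{mπiz}·(v₀+v₁z)e^{m′πiz}` as a `CubE` at rate `m+m′`.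
[cite: Zhang2022LandauSiegel, §12 p.72] -/
def mulLL (t s : LinE) : CubE := ⟨t.u0 * s.u0, t.u0 * s.u1 + t.u1 * s.u0, t.u1 * s.u1, 0⟩

/-- Soundness of `mulLL`. [cite: Zhang2022LandauSiegel, §12 p.72] -/
theorem eval_mulLL (t s : LinE) (m m' : ℚ) (z : ℝ) :
    t.eval m z * s.eval m' z = (mulLL t s).eval (m + m') z := by
  unfold LinE.eval mulLL CubE.eval
  have e : cexp ((m : ℂ) * π * I * z) * cexp ((m' : ℂ) * π * I * z) = cexp ((((m + m' : ℚ)) : ℂ) * π * I * z) := by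
    rw [← Complex.exp_add]; congr 1; push_cast; ring
  linear_combination (t.u0 + t.u1 * z) * (s.u0 + s.u1 * z) * e

/-- the exact-reading weight `−D_j(z − 0.496) = −C_j − (DLin j)(z)e^{(3/2)πiz}`:
`DLin j = e^{−0.744πi}·(A_j − 0.496·B_j, B_j)`. [cite: Zhang2022LandauSiegel, §12 p.70–72] -/
def DLin (j : ℕ) : LinE :=
  ⟨eIpi (-93/125) * (DA j - DB j * (((62/125 : ℚ) : ℝ) : ℂ)), eIpi (-93/125) * DB j⟩

/-- `wExact j z = −C_j − (DLin j).eval (3/2) z`. [cite: Zhang2022LandauSiegel, §12 p.70–72] -/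
theorem wExact_eq (j : ℕ) (z : ℝ) : wExact j z = -(DC j) - (DLin j).eval (3/2) z := by
  unfold wExact; rw [Dmain_closed]; unfold LinE.eval DLin eIpi
  have e : cexp (3 * π * I * (((z - 0.496 : ℝ)) : ℂ) / 2)
      = cexp (((((-93/125 : ℚ)) : ℝ) * π : ℝ) * I) * cexp ((((3/2 : ℚ)) : ℂ) * π * I * z) := by
    rw [← Complex.exp_add]; congr 1; push_cast; ring
  rw [e]; push_cast; ring

/-- the exact-reading conjugate weight `−D1_j(z − 0.496)` as a linear-exponential at rate `−3/2`:
`WsLin j = e^{0.744πi}·(−(1 + (3/2 − j)πi·0.496), (3/2 − j)πi)`. [cite: Zhang2022LandauSiegel, §12 p.68–73] -/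
def WsLin (j : ℕ) : LinE :=
  ⟨-(eIpi (93/125) * (1 + (3 / 2 - (j : ℂ)) * π * I * (((62/125 : ℚ) : ℝ) : ℂ))), eIpi (93/125) * ((3 / 2 - (j : ℂ)) * π * I)⟩

/-- `wStarExact j z = (WsLin j).eval (−3/2) z`. [cite: Zhang2022LandauSiegel, §12 p.68–73] -/
theorem wStarExact_eq (j : ℕ) (z : ℝ) : wStarExact j z = (WsLin j).eval (-3/2) z := by
  unfold wStarExact LinE.eval WsLin eIpi
  have e : cexp (-(3 * π * I * ((z : ℂ) - 0.496) / 2))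
      = cexp (((((93/125 : ℚ)) : ℝ) * π : ℝ) * I) * cexp ((((-3/2 : ℚ)) : ℂ) * π * I * z) := by
    rw [← Complex.exp_add]; congr 1; push_cast; ring
  rw [e]; push_cast; ring

/-- the linearised weight as a linear-exponential at rate `0`: `WlLin j = (−1 − (3−j)πi·0.496, (3−j)πi)`.
[cite: Zhang2022LandauSiegel, §12 p.72] -/
def WlLin (j : ℕ) : LinE := ⟨-1 - (3 - (j : ℂ)) * π * I * (((62/125 : ℚ) : ℝ) : ℂ), (3 - (j : ℂ)) * π * I⟩

/-- `wLin j z = (WlLin j).eval 0 z`. [cite: Zhang2022LandauSiegel, §12 p.72] -/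
theorem wLin_eq (j : ℕ) (z : ℝ) : wLin j z = (WlLin j).eval 0 z := by
  unfold wLin LinE.eval WlLin; push_cast; simp; ring

/-- Closed form of `∫_A^B 𝔣𝔣_{a,k}(c − z)·wExact j z dz`. [cite: Zhang2022LandauSiegel, §12 p.72] -/
def XVal (a k c A B : ℚ) (j : ℕ) : ℂ :=
  (((ffLin a).reflect k c).toCubE.smul (-(DC j))).integ (-k) A B
    + ((mulLL ((ffLin a).reflect k c) (DLin j)).neg).integ (-k + 3/2) A B

/-- `∫_A^B 𝔣𝔣_{a,k}(c − z)·wExact j z dz = XVal a k c A B j`. [cite: Zhang2022LandauSiegel, §12 p.72] -/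
theorem integral_X (a k c A B : ℚ) (j : ℕ) :
    ∫ z in ((A : ℚ) : ℝ)..((B : ℚ) : ℝ), ffF a k (((c : ℚ) : ℝ) - z) * wExact j z = XVal a k c A B j := by
  have p : ∀ z : ℝ, ffF a k (((c : ℚ) : ℝ) - z) * wExact j z
      = (((ffLin a).reflect k c).toCubE.smul (-(DC j))).eval (-k) z
        + ((mulLL ((ffLin a).reflect k c) (DLin j)).neg).eval (-k + 3/2) z := by
    intro z
    rw [ffF_eq_eval, LinE.eval_reflect, wExact_eq, ← CubE.neg_eval, ← eval_mulLL, ← CubE.smul_eval,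
      ← LinE.eval_toCubE]
    ring
  rw [intervalIntegral.integral_congr (fun z _ => p z), CubE.integral_add_eq]; rfl

/-- Closed form of `∫_A^B 𝔤𝔥_{r₀,r₁,b,k}(c − z)·wStarExact j z dz`. [cite: Zhang2022LandauSiegel, §12 p.73] -/
def YVal (r0 r1 b k c A B : ℚ) (j : ℕ) : ℂ :=
  (mulLL ((gh0Lin r0).reflect 0 c) (WsLin j)).integ (-3/2) A B
    + (mulLL ((gh1Lin r1 b).reflect (-k) c) (WsLin j)).integ (k - 3/2) A B

/-- `∫_A^B 𝔤𝔥(c − z)·wStarExact j z dz = YVal …`. [cite: Zhang2022LandauSiegel, §12 p.73] -/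
theorem integral_Y (r0 r1 b k c A B : ℚ) (j : ℕ) :
    ∫ z in ((A : ℚ) : ℝ)..((B : ℚ) : ℝ), ghF r0 r1 b k (((c : ℚ) : ℝ) - z) * wStarExact j z = YVal r0 r1 b k c A B j := by
  have p : ∀ z : ℝ, ghF r0 r1 b k (((c : ℚ) : ℝ) - z) * wStarExact j z
      = (mulLL ((gh0Lin r0).reflect 0 c) (WsLin j)).eval (-3/2) z
        + (mulLL ((gh1Lin r1 b).reflect (-k) c) (WsLin j)).eval (k - 3/2) z := by
    intro z
    rw [ghF_eq_eval, LinE.eval_reflect, LinE.eval_reflect, wStarExact_eq, add_mul, eval_mulLL, eval_mulLL]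
    have h1 : (-(0 : ℚ) + -3/2 : ℚ) = -3/2 := by norm_num
    have h2 : (-(-k) + -3/2 : ℚ) = k - 3/2 := by ring
    rw [h1, h2]
  rw [intervalIntegral.integral_congr (fun z _ => p z), CubE.integral_add_eq]; rfl

/-- Closed form of `∫_A^B 𝔤𝔥(c − z)·wLin j z dz`. [cite: Zhang2022LandauSiegel, §12 p.73] -/
def JVal (r0 r1 b k c A B : ℚ) (j : ℕ) : ℂ :=
  (mulLL ((gh0Lin r0).reflect 0 c) (WlLin j)).integ 0 A B
    + (mulLL ((gh1Lin r1 b).reflect (-k) c) (WlLin j)).integ k A B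

/-- `∫_A^B 𝔤𝔥(c − z)·wLin j z dz = JVal …`. [cite: Zhang2022LandauSiegel, §12 p.73] -/
theorem integral_J (r0 r1 b k c A B : ℚ) (j : ℕ) :
    ∫ z in ((A : ℚ) : ℝ)..((B : ℚ) : ℝ), ghF r0 r1 b k (((c : ℚ) : ℝ) - z) * wLin j z = JVal r0 r1 b k c A B j := by
  have p : ∀ z : ℝ, ghF r0 r1 b k (((c : ℚ) : ℝ) - z) * wLin j z
      = (mulLL ((gh0Lin r0).reflect 0 c) (WlLin j)).eval 0 z
        + (mulLL ((gh1Lin r1 b).reflect (-k) c) (WlLin j)).eval k z := by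
    intro z
    rw [ghF_eq_eval, LinE.eval_reflect, LinE.eval_reflect, wLin_eq, add_mul, eval_mulLL, eval_mulLL]
    norm_num
  rw [intervalIntegral.integral_congr (fun z _ => p z), CubE.integral_add_eq]; rfl

/-- The six exact-reading `𝔣𝔣`-window integrals and the six `𝔤𝔥`-window integrals (both readings) in closed form.
[cite: Zhang2022LandauSiegel, §12 p.72–73] -/
theorem windows_exact_eq :
    I6 wExact 1 = XVal (1/2) (3/2) (249/500) (62/125) (249/500) 1 ∧ I6 wExact 2 = XVal (-1/2) (3/2) (249/500) (62/125) (249/500) 2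
    ∧ I6 wExact 3 = XVal (-3/2) (3/2) (249/500) (62/125) (249/500) 3
    ∧ I7 wExact 1 = XVal (3/2) (5/2) (1/2) (62/125) (1/2) 1 ∧ I7 wExact 2 = XVal (1/2) (5/2) (1/2) (62/125) (1/2) 2
    ∧ I7 wExact 3 = XVal (-1/2) (5/2) (1/2) (62/125) (1/2) 3 := by
  unfold I6 I7
  simp only [ffj6, ffj7, ff16, ff26, ff36, ff17, ff27, ff37, dR0496, dR0498, dR05]
  refine ⟨integral_X _ _ _ _ _ _, integral_X _ _ _ _ _ _, integral_X _ _ _ _ _ _, integral_X _ _ _ _ _ _,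
    integral_X _ _ _ _ _ _, integral_X _ _ _ _ _ _⟩

/-- see `windows_exact_eq`: the `𝔤𝔥`-side. [cite: Zhang2022LandauSiegel, §12 p.73] -/
theorem windows_gh_eq :
    J6 wStarExact 1 = YVal (8/3) (-5/3) (-1/2) (3/2) (249/500) (62/125) (249/500) 1
    ∧ J6 wStarExact 2 = YVal (4/3) (-1/3) (1/2) (3/2) (249/500) (62/125) (249/500) 2
    ∧ J6 wStarExact 3 = YVal (8/9) (1/9) (1/6) (3/2) (249/500) (62/125) (249/500) 3
    ∧ J7 wStarExact 1 = YVal (24/25) (1/25) (1/10) (5/2) (1/2) (62/125) (1/2) 1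
    ∧ J7 wStarExact 2 = YVal (12/25) (13/25) (3/10) (5/2) (1/2) (62/125) (1/2) 2
    ∧ J7 wStarExact 3 = YVal (8/25) (17/25) (-3/10) (5/2) (1/2) (62/125) (1/2) 3
    ∧ J6 wLin 1 = JVal (8/3) (-5/3) (-1/2) (3/2) (249/500) (62/125) (249/500) 1
    ∧ J6 wLin 2 = JVal (4/3) (-1/3) (1/2) (3/2) (249/500) (62/125) (249/500) 2
    ∧ J6 wLin 3 = JVal (8/9) (1/9) (1/6) (3/2) (249/500) (62/125) (249/500) 3
    ∧ J7 wLin 1 = JVal (24/25) (1/25) (1/10) (5/2) (1/2) (62/125) (1/2) 1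
    ∧ J7 wLin 2 = JVal (12/25) (13/25) (3/10) (5/2) (1/2) (62/125) (1/2) 2
    ∧ J7 wLin 3 = JVal (8/25) (17/25) (-3/10) (5/2) (1/2) (62/125) (1/2) 3 := by
  unfold J6 J7
  simp only [ghj6, ghj7, gh16, gh26, gh36, gh17, gh27, gh37, dR0496, dR0498, dR05]
  refine ⟨integral_Y _ _ _ _ _ _ _ _, integral_Y _ _ _ _ _ _ _ _, integral_Y _ _ _ _ _ _ _ _,
    integral_Y _ _ _ _ _ _ _ _, integral_Y _ _ _ _ _ _ _ _, integral_Y _ _ _ _ _ _ _ _,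
    integral_J _ _ _ _ _ _ _ _, integral_J _ _ _ _ _ _ _ _, integral_J _ _ _ _ _ _ _ _,
    integral_J _ _ _ _ _ _ _ _, integral_J _ _ _ _ _ _ _ _, integral_J _ _ _ _ _ _ _ _⟩

/-! ### Boxes for the exact-reading closed forms -/

/- Keep the interval primitives opaque to the elaborator's unifier (as in `Section8Certificate`). -/
attribute [local irreducible] CB.add CB.sub CB.mul CB.neg CB.conj CB.mulFI CB.mulI CB.mulInt
  CB.ofFI CB.ofInt CB.normSqFI CB.expI FI.add FI.sub FI.mul FI.neg FI.mulInt FI.divNat FI.divPos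
  FI.ofRat FI.ofInt FI.pi qCB piMul expIpi overPiFI piISq eIpiB overPiB

/-- `(π:ℂ)² ∈` the box of `π·π`. [cite: Zhang2022LandauSiegel, §12 p.70] -/
theorem mem_piSqC : CB.mem ((π : ℂ) ^ 2) (CB.ofFI (FI.pi.mul FI.pi)) := by
  have h := CB.mem_ofFI mem_piSq
  have e : (((π * π : ℝ)) : ℂ) = (π : ℂ) ^ 2 := by push_cast; ring
  rw [e] at h; exact h

/-- box of `w = (2/3)/π` as a complex number [cite: Zhang2022LandauSiegel, §12 p.70] -/
@[irreducible] def wKC : CB := CB.ofFI (overPiB (2/3))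
/-- `(w : ℂ) ∈ wKC`. [cite: Zhang2022LandauSiegel, §12 p.70] -/
theorem mem_wKC : CB.mem ((wK : ℝ) : ℂ) wKC := by unfold wK wKC; exact mem_overPiC (2/3)

/-- box of `C_j` [cite: Zhang2022LandauSiegel, §12 p.70] -/
@[irreducible] def DCB (j : ℕ) : CB :=
  (eIpiB (3/500)).mul (((CB.ofInt (nj j)).mul (CB.ofFI (FI.pi.mul FI.pi))).mul
    ((wKC.mul wKC).sub ((wKC.mulI).mul (qCB (1/250)))))
/-- box of `A_j` [cite: Zhang2022LandauSiegel, §12 p.70] -/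
@[irreducible] def DAB (j : ℕ) : CB := (CB.ofInt 1).sub (((CB.ofInt (nj j)).mul (CB.ofFI (FI.pi.mul FI.pi))).mul (wKC.mul wKC))
/-- box of `B_j` [cite: Zhang2022LandauSiegel, §12 p.70] -/
@[irreducible] def DBB (j : ℕ) : CB :=
  ((((CB.ofInt (nj j)).mul (CB.ofFI (FI.pi.mul FI.pi))).mul wKC).mulI).sub ((((qCB (9/2)).sub (CB.ofInt j)).mulFI FI.pi).mulI)

/-- `C_j ∈ DCB j`. [cite: Zhang2022LandauSiegel, §12 p.70] -/
theorem mem_DCB (j : ℕ) : CB.mem (DC j) (DCB j) := by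
  have hw := mem_wKC
  have e : (wK : ℂ) ^ 2 = (wK : ℂ) * (wK : ℂ) := sq _
  unfold DC DCB; rw [e]
  exact CB.mem_mul (mem_eIpiB _) (CB.mem_mul (CB.mem_mul (mem_natCB _) mem_piSqC)
    (CB.mem_sub (CB.mem_mul hw hw) (CB.mem_mul (CB.mem_mulI hw) (mem_qCB' _))))
/-- `A_j ∈ DAB j`. [cite: Zhang2022LandauSiegel, §12 p.70] -/
theorem mem_DAB (j : ℕ) : CB.mem (DA j) (DAB j) := by
  have hw := mem_wKC
  have e : (wK : ℂ) ^ 2 = (wK : ℂ) * (wK : ℂ) := sq _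
  unfold DA DAB; rw [e]
  exact CB.mem_sub mem_oneCB (CB.mem_mul (CB.mem_mul (mem_natCB _) mem_piSqC) (CB.mem_mul hw hw))
/-- `B_j ∈ DBB j`. [cite: Zhang2022LandauSiegel, §12 p.70] -/
theorem mem_DBB (j : ℕ) : CB.mem (DB j) (DBB j) := by
  have hw := mem_wKC
  have h92 : CB.mem ((9 : ℂ) / 2) (qCB (9/2)) := by simpa using mem_qCB (9/2)
  unfold DB DBB
  exact CB.mem_sub (CB.mem_mulI (CB.mem_mul (CB.mem_mul (mem_natCB _) mem_piSqC) hw))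
    (CB.mem_mulI (CB.mem_mulFI (CB.mem_sub h92 (mem_natCB j)) FI.mem_pi))

/-- box mirror of `DLin` [cite: Zhang2022LandauSiegel, §12 p.70–72] -/
@[irreducible] def DLinB (j : ℕ) : LinEB :=
  ⟨(eIpiB (-93/125)).mul ((DAB j).sub ((DBB j).mul (qCB (62/125)))), (eIpiB (-93/125)).mul (DBB j)⟩
/-- `DLin j ∈ DLinB j`. [cite: Zhang2022LandauSiegel, §12 p.70–72] -/
theorem mem_DLinB (j : ℕ) : LinEB.Mem (DLin j) (DLinB j) := by
  unfold DLin DLinB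
  exact ⟨CB.mem_mul (mem_eIpiB _) (CB.mem_sub (mem_DAB j) (CB.mem_mul (mem_DBB j) (mem_qCB' _))),
    CB.mem_mul (mem_eIpiB _) (mem_DBB j)⟩

/-- box mirror of `WsLin` [cite: Zhang2022LandauSiegel, §12 p.68–73] -/
@[irreducible] def WsLinB (j : ℕ) : LinEB :=
  ⟨((eIpiB (93/125)).mul ((CB.ofInt 1).add (((((qCB (3/2)).sub (CB.ofInt j)).mulFI FI.pi).mulI).mul (qCB (62/125))))).neg,
    (eIpiB (93/125)).mul ((((qCB (3/2)).sub (CB.ofInt j)).mulFI FI.pi).mulI)⟩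
/-- `WsLin j ∈ WsLinB j`. [cite: Zhang2022LandauSiegel, §12 p.68–73] -/
theorem mem_WsLinB (j : ℕ) : LinEB.Mem (WsLin j) (WsLinB j) := by
  have h32 : CB.mem ((3 : ℂ) / 2) (qCB (3/2)) := by simpa using mem_qCB (3/2)
  have ha : CB.mem ((3 / 2 - (j : ℂ)) * π * I) ((((qCB (3/2)).sub (CB.ofInt j)).mulFI FI.pi).mulI) :=
    CB.mem_mulI (CB.mem_mulFI (CB.mem_sub h32 (mem_natCB j)) FI.mem_pi)
  unfold WsLin WsLinB
  refine ⟨CB.mem_neg (CB.mem_mul (mem_eIpiB _) (CB.mem_add mem_oneCB ?_)), CB.mem_mul (mem_eIpiB _) ha⟩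
  have e : (1 : ℂ) + (3 / 2 - (j : ℂ)) * π * I * ((((62/125 : ℚ) : ℝ)) : ℂ)
      = 1 + ((3 / 2 - (j : ℂ)) * π * I) * ((((62/125 : ℚ) : ℝ)) : ℂ) := by ring
  simpa using CB.mem_mul ha (mem_qCB' (62/125))

/-- box mirror of `WlLin` [cite: Zhang2022LandauSiegel, §12 p.72] -/
@[irreducible] def WlLinB (j : ℕ) : LinEB :=
  ⟨((CB.ofInt 1).neg).sub (((((CB.ofInt 3).sub (CB.ofInt j)).mulFI FI.pi).mulI).mul (qCB (62/125))),
    (((CB.ofInt 3).sub (CB.ofInt j)).mulFI FI.pi).mulI⟩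
/-- `WlLin j ∈ WlLinB j`. [cite: Zhang2022LandauSiegel, §12 p.72] -/
theorem mem_WlLinB (j : ℕ) : LinEB.Mem (WlLin j) (WlLinB j) := by
  have h3 : CB.mem (3 : ℂ) (CB.ofInt 3) := by simpa using CB.mem_ofInt 3
  have hb : CB.mem ((3 - (j : ℂ)) * π * I) ((((CB.ofInt 3).sub (CB.ofInt j)).mulFI FI.pi).mulI) :=
    CB.mem_mulI (CB.mem_mulFI (CB.mem_sub h3 (mem_natCB j)) FI.mem_pi)
  unfold WlLin WlLinB
  exact ⟨CB.mem_sub (CB.mem_neg mem_oneCB) (by simpa [mul_assoc] using CB.mem_mul hb (mem_qCB' (62/125))),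
    hb⟩

/-- box mirror of `mulLL` [cite: Zhang2022LandauSiegel, §12 p.72] -/
def mulLLB (T S : LinEB) : CubEB := ⟨T.u0.mul S.u0, (T.u0.mul S.u1).add (T.u1.mul S.u0), T.u1.mul S.u1, CB.ofInt 0⟩
/-- Soundness of `mulLLB`. [cite: Zhang2022LandauSiegel, §12 p.72] -/
theorem mem_mulLLB {t s : LinE} {T S : LinEB} (ht : LinEB.Mem t T) (hs : LinEB.Mem s S) :
    CubEB.Mem (mulLL t s) (mulLLB T S) := by
  obtain ⟨h0, h1⟩ := ht
  obtain ⟨g0, g1⟩ := hs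
  exact ⟨CB.mem_mul h0 g0, CB.mem_add (CB.mem_mul h0 g1) (CB.mem_mul h1 g0), CB.mem_mul h1 g1, mem_zeroCB⟩

/-- negation of a `CubEB` [cite: Zhang2022LandauSiegel, §12 p.72] -/
def negC3 (T : CubEB) : CubEB := ⟨T.c0.neg, T.c1.neg, T.c2.neg, T.c3.neg⟩
/-- Soundness of `negC3`. [cite: Zhang2022LandauSiegel, §12 p.72] -/
theorem mem_negC3 {t : CubE} {T : CubEB} (h : CubEB.Mem t T) : CubEB.Mem t.neg (negC3 T) := by
  obtain ⟨h0, h1, h2, h3⟩ := h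
  exact ⟨CB.mem_neg h0, CB.mem_neg h1, CB.mem_neg h2, CB.mem_neg h3⟩

/-- box mirror of `XVal` [cite: Zhang2022LandauSiegel, §12 p.72] -/
@[irreducible] def XValB (a k c A B : ℚ) (j : ℕ) : CB :=
  ((((ffLinB a).reflect k c).toCubE.smul (DCB j).neg).integ (-k) A B).add
    ((negC3 (mulLLB ((ffLinB a).reflect k c) (DLinB j))).integ (-k + 3/2) A B)
/-- `XVal … ∈ XValB …`. [cite: Zhang2022LandauSiegel, §12 p.72] -/
theorem mem_XValB (a k c A B : ℚ) (j : ℕ) : CB.mem (XVal a k c A B j) (XValB a k c A B j) := by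
  unfold XVal XValB
  exact CB.mem_add
    (CubEB.mem_integ (CubEB.mem_smul (LinEB.mem_toCubE (LinEB.mem_reflect (mem_ffLinB a) k c))
      (CB.mem_neg (mem_DCB j))) _ _ _)
    (CubEB.mem_integ (mem_negC3 (mem_mulLLB (LinEB.mem_reflect (mem_ffLinB a) k c) (mem_DLinB j))) _ _ _)

/-- box mirror of `YVal` [cite: Zhang2022LandauSiegel, §12 p.73] -/
@[irreducible] def YValB (r0 r1 b k c A B : ℚ) (j : ℕ) : CB :=
  ((mulLLB ((gh0LinB r0).reflect 0 c) (WsLinB j)).integ (-3/2) A B).add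
    ((mulLLB ((gh1LinB r1 b).reflect (-k) c) (WsLinB j)).integ (k - 3/2) A B)
/-- `YVal … ∈ YValB …`. [cite: Zhang2022LandauSiegel, §12 p.73] -/
theorem mem_YValB (r0 r1 b k c A B : ℚ) (j : ℕ) : CB.mem (YVal r0 r1 b k c A B j) (YValB r0 r1 b k c A B j) := by
  unfold YVal YValB
  exact CB.mem_add
    (CubEB.mem_integ (mem_mulLLB (LinEB.mem_reflect (mem_gh0LinB r0) 0 c) (mem_WsLinB j)) _ _ _)
    (CubEB.mem_integ (mem_mulLLB (LinEB.mem_reflect (mem_gh1LinB r1 b) (-k) c) (mem_WsLinB j)) _ _ _)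

/-- box mirror of `JVal` [cite: Zhang2022LandauSiegel, §12 p.73] -/
@[irreducible] def JValB (r0 r1 b k c A B : ℚ) (j : ℕ) : CB :=
  ((mulLLB ((gh0LinB r0).reflect 0 c) (WlLinB j)).integ 0 A B).add
    ((mulLLB ((gh1LinB r1 b).reflect (-k) c) (WlLinB j)).integ k A B)
/-- `JVal … ∈ JValB …`. [cite: Zhang2022LandauSiegel, §12 p.73] -/
theorem mem_JValB (r0 r1 b k c A B : ℚ) (j : ℕ) : CB.mem (JVal r0 r1 b k c A B j) (JValB r0 r1 b k c A B j) := by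
  unfold JVal JValB
  exact CB.mem_add
    (CubEB.mem_integ (mem_mulLLB (LinEB.mem_reflect (mem_gh0LinB r0) 0 c) (mem_WlLinB j)) _ _ _)
    (CubEB.mem_integ (mem_mulLLB (LinEB.mem_reflect (mem_gh1LinB r1 b) (-k) c) (mem_WlLinB j)) _ _ _)

end Literature.NumberTheory.LFunctions.Zhang2022.Numerics
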